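/-
Copyright (c) 2026 the pub-hodgecm-mathlib formalisation cell (harness21).  Prover seat hodgecm-mathlib-R90-C10-p07 (g0) acting for R90-TF section S8 «ContSpec-n½»
(dealer R90-CS-plan (g2), S8-R53 ∕ S8-R56: «(W) shell U3»): the Iwasawa weight of an UNRAMIFIED character along the `U(2,1)` big cell is SHELL-GEOMETRIC — the shell
letters of ★ `K2E1ChiIntertwiningLocalScalarU3` (inert) and ★ `K2E1ChiIntertwiningLocalScalarSplitU3` (split), in their exact bytes, from the torus-entry letters.
-/
import Summits.HodgeConjecture.HodgeConjecture.Theorems.K2E1IntertwiningLocalMeanCMU3   -- ★ `placesOver_good` (`q_w = q_v²` at a non-split unramified place) + the N = 3 local height currency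
import HarnessLib

/-!
# K2·E1 ∕ R90·S8 — `K2E1ChiLocalWeightShellU3` ((W) shell letters, N = 3): THE IWASAWA WEIGHT OF AN UNRAMIFIED CHARACTER ALONG THE `U(2,1)` BIG CELL IS SHELL-GEOMETRIC

Cell `pub/hodgecm-mathlib`, crux h413 = `stmt-HodgeConjecture-24833`, route of record `HCCMUnconditional`; R90-TF section S8 (census `R90/S8/CENSUS-sock3-piN.R90-C10-p07-g0.md` B1,
(NV) road of socket #3).  THEOREMS ONLY (no `def`, no `instance`, no notation, no named-fact hypothesis, no `sorry`; default heartbeats); lane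
`--supports stmt-HodgeConjecture-24833 --as helper` (count-neutral).  The `N = 3` twin of ★ `K2E1ChiLocalWeightShellU2` (R90-C10-p07, p862239).

THE MATHEMATICS ([Casselman1980] §3; [Rogawski1990] §4.5, §13.9; [Langlands1971] §3).  Along the big cell `ι(w₀)·u(X,Z) = u′·m(α,β)·k` (Iwasawa), a Borel character `χ` evaluates
to `χ(m(α,β))`; an UNRAMIFIED `χ` sees only the VALUATIONS of the torus entries, and the valuation of a torus entry is the corresponding HEIGHT: `‖α‖ = Q⁻¹` where `Q ≥ 1` is the
sup-norm height factor (inert `w ∣ v`: `Q_v = max(1,‖X_w‖,‖Z_w‖)`, pivot `Z_w`; split `v`: the two Gindikin–Karpelevich factors `A = max(1,|x|,|z|)`, `B = max(1,|y|,|z−xy|)` =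
`|t₃|`, `|t₂t₃|` of `GL₃`).  Hence on the shell `{Q = q^k}` the weight is `χ(ϖ)^k`: the weight is SHELL-GEOMETRIC.  This file proves exactly that reduction, for ANY height
function `Q ≥ 1` on ANY parameter space, from the two (W)-side LETTERS (the content of the Iwasawa factorisation, NOT proved here): (α) a torus-entry function `α` with
`‖α(p)‖·Q(p) = 1` off the unit shell, and (c) the weight is `1` on `{Q = 1}` and `χ(α(p))` on `{Q > 1}`.  §2–§3 then print the shell letters of the two ★ local-token files
in their EXACT bytes: inert `∃ k, Q_v p = q_v^{2k} ∧ ω p = e^k` (★ `chiLocalMean_eq_token_of_shell_nonsplit`, `q_w = q_v²`), split `∃ a b, A = q^a ∧ B = q^b ∧ ω = u₁^a·u₂^b`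
(★ `chiLocalIntegral_eq_token_of_shell_split`, K2E1-p13).
HONEST LABEL: HC_CM is proved only modulo the 7 printed citations (2 remaining named inputs: hLiu418 = `stmt-HodgeConjecture-24832`, h413 = `stmt-HodgeConjecture-24833`) until rung 0
closes; this file asserts no named fact and closes no socket; its letters (α)(c) = the explicit Iwasawa factorisation of `ι(w₀)·u(X,Z)` (inert: `α = Z̄_w⁻¹`; split: the `GL₃` minors)
are a separate brick; count-neutral; unconditional local algebra.

* §1 generic (any non-archimedean local field `F`, any `Q ≥ 1`): `chi_eq_pow_of_normAbs_eq` (unramified `χ` sees norms), **`shell_of_unramified_weight`**.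
* §2 inert `U(2,1)`: **`shell_nonsplit_of_torusEntry`** — ★ B1-local's `hshell` bytes.
* §3 split (base coordinates, generic `F`, `‖δ₁‖ = ‖2‖ = 1` not even needed): **`shell_split_of_torusEntries`** — ★ p13's `hshell` bytes.

## References
* [Casselman1980] W. Casselman, *The unramified principal series of p-adic groups I*, Compositio Math. 40 (1980), §3.
* [Rogawski1990] J. D. Rogawski, *Automorphic Representations of Unitary Groups in Three Variables* (1990), §4.5 p. 45; §13.9 p. 229.
* [Langlands1971] R. P. Langlands, *Euler Products* (1971), §3.
-/

set_option autoImplicit false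
set_option linter.dupNamespace false -- the mandated namespace repeats `HodgeConjecture.HodgeConjecture`

noncomputable section

open NumberField IsDedekindDomain
open scoped NNReal
open Literature.NumberTheory.Automorphic Literature.NumberTheory.Automorphic.UnitaryGroup Literature.NumberTheory.GaloisRepresentations
open Literature.NumberTheory.GaloisRepresentations.IsNonarchimedeanLocalField
open Summit.HodgeConjecture.HodgeConjecture.Cruxes.H413.K2E1IntertwiningLocalMeanCMU3 (placesOver_good)

namespace Summit.HodgeConjecture.HodgeConjecture.Cruxes.H413.K2E1ChiLocalWeightShellU3

/-! ## §1 Generic: an unramified character of `F^×` sees only norms; shell-geometry of a weight read on a torus entry of norm `Q⁻¹` -/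

section Generic

variable {F : Type*} [Field F] [ValuativeRel F] [TopologicalSpace F] [IsNonarchimedeanLocalField F]

/-- **An unramified character sees only norms**: if `χ` is trivial on `{‖u‖ = 1}` and `‖a‖ = ‖π‖^k`, then `χ(a) = χ(π)^k`. [cite: Casselman1980, §3] -/
theorem chi_eq_pow_of_normAbs_eq (χ : Fˣ →* ℂˣ) (hχ : ∀ u : Fˣ, normAbs F (u : F) = 1 → χ u = 1) (a π : Fˣ) (k : ℕ)
    (h : normAbs F (a : F) = normAbs F (π : F) ^ k) : χ a = χ π ^ k := by
  have hπ0 : normAbs F (π : F) ≠ 0 := fun h0 => π.ne_zero ((map_eq_zero (normAbs F)).1 h0)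
  have hu : normAbs F ((a * (π ^ k)⁻¹ : Fˣ) : F) = 1 := by
    rw [Units.val_mul, Units.val_inv_eq_inv_val, Units.val_pow_eq_pow_val, map_mul, map_inv₀, map_pow, h, mul_inv_cancel₀ (pow_ne_zero _ hπ0)]
  have h1 := hχ _ hu
  rw [map_mul, map_inv, map_pow, mul_inv_eq_one] at h1
  exact h1

/-- **SHELL-GEOMETRY OF A WEIGHT READ ON A TORUS ENTRY** (any non-archimedean local field `F`, any parameter space `P`, any height `Q ≥ 1`).  Letters: (α) `α : P → F^×` with
`‖α(p)‖·Q(p) = 1` whenever `Q(p) > 1`; (c) the weight `c` is `1` on `{Q = 1}` and `χ(α(p))` on `{Q > 1}`, `χ` unramified (trivial on `{‖u‖ = 1}`), `π` a uniformizer (`‖π‖ = q⁻¹`).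
THEN every `p` lies on a shell: `Q(p) = q^k` and `c(p) = χ(π)^k` for some `k : ℕ`. [cite: Casselman1980, §3] [cite: Langlands1971, §3] -/
theorem shell_of_unramified_weight {P : Type*} (Q : P → ℝ) (hQ1 : ∀ p, 1 ≤ Q p)
    (χ : Fˣ →* ℂˣ) (hχ : ∀ u : Fˣ, normAbs F (u : F) = 1 → χ u = 1) (π : Fˣ) (hπ : normAbs F (π : F) = (residueFieldCard F : ℝ≥0)⁻¹)
    (α : P → Fˣ) (hα : ∀ p, 1 < Q p → ((normAbs F (α p : F) : ℝ≥0) : ℝ) * Q p = 1)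
    (c : P → ℂ) (hc1 : ∀ p, Q p = 1 → c p = 1) (hcQ : ∀ p, 1 < Q p → c p = ((χ (α p) : ℂˣ) : ℂ)) (p : P) :
    ∃ k : ℕ, Q p = (residueFieldCard F : ℝ) ^ k ∧ c p = ((χ π : ℂˣ) : ℂ) ^ k := by
  rcases (hQ1 p).eq_or_lt with h1 | h1
  · exact ⟨0, by rw [pow_zero, ← h1], by rw [pow_zero, hc1 p h1.symm]⟩
  · have hq1 : (1 : ℝ) < residueFieldCard F := by exact_mod_cast (one_lt_residueFieldCard (F := F))
    have hq0 : (0 : ℝ) < residueFieldCard F := one_pos.trans hq1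
    obtain ⟨n, hn⟩ := exists_normAbs_eq_inv_zpow (α p).ne_zero
    -- `‖α p‖ = q^{-n}` and `‖α p‖·Q p = 1` give `Q p = q^n` with `n > 0`
    have hnR : ((normAbs F (α p : F) : ℝ≥0) : ℝ) = (residueFieldCard F : ℝ) ^ (-n) := by
      rw [hn, NNReal.coe_zpow, NNReal.coe_inv, inv_zpow', NNReal.coe_natCast]
    have hQ : Q p = (residueFieldCard F : ℝ) ^ n := by
      have h := hα p h1
      rw [hnR, zpow_neg, inv_mul_eq_one₀ (zpow_ne_zero n hq0.ne')] at h
      exact h.symm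
    have hnpos : 0 < n := by
      by_contra hle
      push Not at hle
      have : Q p ≤ 1 := by rw [hQ]; exact zpow_le_one_of_nonpos₀ hq1.le hle
      linarith
    obtain ⟨k, hk⟩ := Int.eq_ofNat_of_zero_le hnpos.le
    refine ⟨k, by rw [hQ, hk, zpow_natCast], ?_⟩
    rw [hcQ p h1, ← Units.val_pow_eq_pow_val, chi_eq_pow_of_normAbs_eq χ hχ (α p) π k ?_]
    rw [hn, hπ, hk, zpow_natCast]

end Generic

/-! ## §2 The inert shell letter of ★ `K2E1ChiIntertwiningLocalScalarU3` (`Q_v = q_v^{2k}`, `ω = e^k`) -/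

variable (L : Type) [Field L] [NumberField L] [IsCMField L] {δ : L} (hcδ : IsCMField.complexConj L δ = -δ) (hδ : δ ≠ 0)
  (v : HeightOneSpectrum (𝓞 ↥(maximalRealSubfield L)))

/-- **THE INERT SHELL LETTER FROM THE TORUS-ENTRY LETTERS** — ★ B1-local `chiLocalMean_eq_token_of_shell_nonsplit`'s `hshell`, byte for byte.  At a place `v` of `L⁺` UNRAMIFIED in `L`
with a NON-SPLIT `w ∣ v` (`q_w = q_v²`, ★ `placesOver_good`): an unramified character `χ_w` of `L_w^×` (trivial on units), a uniformizer `π_w` (`‖π_w‖ = q_w⁻¹`), a torus-entry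
function `α` with `‖α(p)‖_w·Q_v(p) = 1` off the unit shell ((α): the Iwasawa torus entry of `ι(w₀)·u(X,Z)` at `w`, `‖α‖ = ‖Z_w‖⁻¹ = Q_v⁻¹`), and a weight `ω` equal to `1` on `{Q_v = 1}` and to
`χ_w(α(p))` on `{Q_v > 1}` ((c)).  THEN `∀ p, ∃ k : ℕ, Q_v p = q_v^{2k} ∧ ω p = e^k`, `e = χ_w(π_w)`. [cite: Casselman1980, §3] [cite: Rogawski1990, §4.5 p. 45] -/
theorem shell_nonsplit_of_torusEntry (hunr : Algebra.IsUnramifiedIn (𝓞 L) v.asIdeal) (w : PlacesOver L v) (hw : IsCMField.complexConj L • w.1 = w.1)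
    (χw : (w.1.adicCompletion L)ˣ →* ℂˣ) (hχ : ∀ u : (w.1.adicCompletion L)ˣ, normAbs (w.1.adicCompletion L) (u : w.1.adicCompletion L) = 1 → χw u = 1)
    (πw : (w.1.adicCompletion L)ˣ) (hπ : normAbs (w.1.adicCompletion L) (πw : w.1.adicCompletion L) = (residueFieldCard (w.1.adicCompletion L) : ℝ≥0)⁻¹)
    (α : (Fin 3 → v.adicCompletion ↥(maximalRealSubfield L)) → (w.1.adicCompletion L)ˣ)
    (hα : ∀ p : Fin 3 → v.adicCompletion ↥(maximalRealSubfield L),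
      1 < (∏ w' : PlacesOver L v, max 1 (max ((normAbs (w'.1.adicCompletion L) (quadraticLocalEquiv L v (IsCMField.complexConj L) hcδ hδ (p 0, p 1) w') : ℝ≥0) : ℝ)
          ((normAbs (w'.1.adicCompletion L) ((toLocalRing L v (p 2) * algebraMap L (LocalRing L v) δ -
            toLocalRing L v 2⁻¹ * (quadraticLocalEquiv L v (IsCMField.complexConj L) hcδ hδ (p 0, p 1) *
              conjLocal L (IsCMField.complexConj L) v (quadraticLocalEquiv L v (IsCMField.complexConj L) hcδ hδ (p 0, p 1)))) w') : ℝ≥0) : ℝ))) →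
      ((normAbs (w.1.adicCompletion L) (α p : w.1.adicCompletion L) : ℝ≥0) : ℝ) *
        (∏ w' : PlacesOver L v, max 1 (max ((normAbs (w'.1.adicCompletion L) (quadraticLocalEquiv L v (IsCMField.complexConj L) hcδ hδ (p 0, p 1) w') : ℝ≥0) : ℝ)
          ((normAbs (w'.1.adicCompletion L) ((toLocalRing L v (p 2) * algebraMap L (LocalRing L v) δ -
            toLocalRing L v 2⁻¹ * (quadraticLocalEquiv L v (IsCMField.complexConj L) hcδ hδ (p 0, p 1) *
              conjLocal L (IsCMField.complexConj L) v (quadraticLocalEquiv L v (IsCMField.complexConj L) hcδ hδ (p 0, p 1)))) w') : ℝ≥0) : ℝ))) = 1)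
    (ω : (Fin 3 → v.adicCompletion ↥(maximalRealSubfield L)) → ℂ)
    (hω1 : ∀ p : Fin 3 → v.adicCompletion ↥(maximalRealSubfield L),
      (∏ w' : PlacesOver L v, max 1 (max ((normAbs (w'.1.adicCompletion L) (quadraticLocalEquiv L v (IsCMField.complexConj L) hcδ hδ (p 0, p 1) w') : ℝ≥0) : ℝ)
          ((normAbs (w'.1.adicCompletion L) ((toLocalRing L v (p 2) * algebraMap L (LocalRing L v) δ -
            toLocalRing L v 2⁻¹ * (quadraticLocalEquiv L v (IsCMField.complexConj L) hcδ hδ (p 0, p 1) *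
              conjLocal L (IsCMField.complexConj L) v (quadraticLocalEquiv L v (IsCMField.complexConj L) hcδ hδ (p 0, p 1)))) w') : ℝ≥0) : ℝ))) = 1 → ω p = 1)
    (hωQ : ∀ p : Fin 3 → v.adicCompletion ↥(maximalRealSubfield L),
      1 < (∏ w' : PlacesOver L v, max 1 (max ((normAbs (w'.1.adicCompletion L) (quadraticLocalEquiv L v (IsCMField.complexConj L) hcδ hδ (p 0, p 1) w') : ℝ≥0) : ℝ)
          ((normAbs (w'.1.adicCompletion L) ((toLocalRing L v (p 2) * algebraMap L (LocalRing L v) δ -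
            toLocalRing L v 2⁻¹ * (quadraticLocalEquiv L v (IsCMField.complexConj L) hcδ hδ (p 0, p 1) *
              conjLocal L (IsCMField.complexConj L) v (quadraticLocalEquiv L v (IsCMField.complexConj L) hcδ hδ (p 0, p 1)))) w') : ℝ≥0) : ℝ))) →
      ω p = ((χw (α p) : ℂˣ) : ℂ)) :
    ∀ p : Fin 3 → v.adicCompletion ↥(maximalRealSubfield L), ∃ k : ℕ,
      (∏ w' : PlacesOver L v, max 1 (max ((normAbs (w'.1.adicCompletion L) (quadraticLocalEquiv L v (IsCMField.complexConj L) hcδ hδ (p 0, p 1) w') : ℝ≥0) : ℝ)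
          ((normAbs (w'.1.adicCompletion L) ((toLocalRing L v (p 2) * algebraMap L (LocalRing L v) δ -
            toLocalRing L v 2⁻¹ * (quadraticLocalEquiv L v (IsCMField.complexConj L) hcδ hδ (p 0, p 1) *
              conjLocal L (IsCMField.complexConj L) v (quadraticLocalEquiv L v (IsCMField.complexConj L) hcδ hδ (p 0, p 1)))) w') : ℝ≥0) : ℝ))) =
        (v.residueCard : ℝ) ^ (2 * k) ∧ ω p = ((χw πw : ℂˣ) : ℂ) ^ k := by
  intro p
  obtain ⟨_, hq⟩ := placesOver_good L v hunr w
  obtain ⟨k, hQ, hc⟩ := shell_of_unramified_weight _ (fun p => Finset.one_le_prod fun w' _ => le_max_left _ _) χw hχ πw hπ α hα ω hω1 hωQ p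
  refine ⟨k, ?_, hc⟩
  rw [hQ, residueFieldCard_adicCompletion_eq, hq hw, Nat.cast_pow, ← pow_mul]

/-! ## §3 The split shell letter of ★ `K2E1ChiIntertwiningLocalScalarSplitU3` (`A = q^a`, `B = q^b`, `ω = u₁^a·u₂^b`), base coordinates -/

section Split

variable {F : Type*} [Field F] [ValuativeRel F] [TopologicalSpace F] [IsNonarchimedeanLocalField F]

/-- **THE SPLIT SHELL LETTER FROM THE TORUS-ENTRY LETTERS** — ★ `chiLocalIntegral_eq_token_of_shell_split`'s `hshell` (K2E1-p13), byte for byte, in Gindikin–Karpelevich base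
coordinates over any non-archimedean local field `F` (`A(p) = max(1,|x|,|z|)`, `B(p) = max(1,|y|,|z−xy|)` at `(x,y,z) = Φ(p) = (p₀+δ₁p₁, −(p₀−δ₁p₁), δ₁p₂ − ½(p₀+δ₁p₁)(p₀−δ₁p₁))`).
Letters: unramified characters `χ₁, χ₂` of `F^×`, a uniformizer `π`, torus-entry functions `α₁, α₂` with `‖α₁‖·A = 1` on `{A > 1}`, `‖α₂‖·B = 1` on `{B > 1}` ((α): `|t₃| = A`, `|t₂t₃| = B` in the
`GL₃` Iwasawa decomposition of `w₀·n(x,y,z)`), and the weight factored as `ω = c₁·c₂` with `c_j = 1` on the unit shell and `χ_j(α_j)` off it ((c)).  THEN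
`∀ p, ∃ a b : ℕ, A(p) = q^a ∧ B(p) = q^b ∧ ω(p) = u₁^a·u₂^b`, `u_j = χ_j(π)`. [cite: Casselman1980, §3] [cite: Langlands1971, §3] [cite: Rogawski1990, §4.5 p. 45] -/
theorem shell_split_of_torusEntries (δ₁ : F)
    (χ₁ χ₂ : Fˣ →* ℂˣ) (hχ₁ : ∀ u : Fˣ, normAbs F (u : F) = 1 → χ₁ u = 1) (hχ₂ : ∀ u : Fˣ, normAbs F (u : F) = 1 → χ₂ u = 1)
    (π : Fˣ) (hπ : normAbs F (π : F) = (residueFieldCard F : ℝ≥0)⁻¹)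
    (α₁ α₂ : (Fin 3 → F) → Fˣ)
    (hα₁ : ∀ p : Fin 3 → F, 1 < max 1 (max ((normAbs F (p 0 + δ₁ * p 1) : ℝ≥0) : ℝ) ((normAbs F (δ₁ * p 2 - 2⁻¹ * (p 0 + δ₁ * p 1) * (p 0 - δ₁ * p 1)) : ℝ≥0) : ℝ)) →
      ((normAbs F (α₁ p : F) : ℝ≥0) : ℝ) * max 1 (max ((normAbs F (p 0 + δ₁ * p 1) : ℝ≥0) : ℝ) ((normAbs F (δ₁ * p 2 - 2⁻¹ * (p 0 + δ₁ * p 1) * (p 0 - δ₁ * p 1)) : ℝ≥0) : ℝ)) = 1)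
    (hα₂ : ∀ p : Fin 3 → F, 1 < max 1 (max ((normAbs F (-(p 0 - δ₁ * p 1)) : ℝ≥0) : ℝ)
          ((normAbs F (δ₁ * p 2 - 2⁻¹ * (p 0 + δ₁ * p 1) * (p 0 - δ₁ * p 1) - (p 0 + δ₁ * p 1) * (-(p 0 - δ₁ * p 1))) : ℝ≥0) : ℝ)) →
      ((normAbs F (α₂ p : F) : ℝ≥0) : ℝ) * max 1 (max ((normAbs F (-(p 0 - δ₁ * p 1)) : ℝ≥0) : ℝ)
          ((normAbs F (δ₁ * p 2 - 2⁻¹ * (p 0 + δ₁ * p 1) * (p 0 - δ₁ * p 1) - (p 0 + δ₁ * p 1) * (-(p 0 - δ₁ * p 1))) : ℝ≥0) : ℝ)) = 1)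
    (c₁ c₂ ω : (Fin 3 → F) → ℂ)
    (hc₁1 : ∀ p : Fin 3 → F, max 1 (max ((normAbs F (p 0 + δ₁ * p 1) : ℝ≥0) : ℝ) ((normAbs F (δ₁ * p 2 - 2⁻¹ * (p 0 + δ₁ * p 1) * (p 0 - δ₁ * p 1)) : ℝ≥0) : ℝ)) = 1 → c₁ p = 1)
    (hc₁A : ∀ p : Fin 3 → F, 1 < max 1 (max ((normAbs F (p 0 + δ₁ * p 1) : ℝ≥0) : ℝ) ((normAbs F (δ₁ * p 2 - 2⁻¹ * (p 0 + δ₁ * p 1) * (p 0 - δ₁ * p 1)) : ℝ≥0) : ℝ)) →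
      c₁ p = ((χ₁ (α₁ p) : ℂˣ) : ℂ))
    (hc₂1 : ∀ p : Fin 3 → F, max 1 (max ((normAbs F (-(p 0 - δ₁ * p 1)) : ℝ≥0) : ℝ)
          ((normAbs F (δ₁ * p 2 - 2⁻¹ * (p 0 + δ₁ * p 1) * (p 0 - δ₁ * p 1) - (p 0 + δ₁ * p 1) * (-(p 0 - δ₁ * p 1))) : ℝ≥0) : ℝ)) = 1 → c₂ p = 1)
    (hc₂B : ∀ p : Fin 3 → F, 1 < max 1 (max ((normAbs F (-(p 0 - δ₁ * p 1)) : ℝ≥0) : ℝ)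
          ((normAbs F (δ₁ * p 2 - 2⁻¹ * (p 0 + δ₁ * p 1) * (p 0 - δ₁ * p 1) - (p 0 + δ₁ * p 1) * (-(p 0 - δ₁ * p 1))) : ℝ≥0) : ℝ)) →
      c₂ p = ((χ₂ (α₂ p) : ℂˣ) : ℂ))
    (hω : ∀ p : Fin 3 → F, ω p = c₁ p * c₂ p) :
    ∀ p : Fin 3 → F, ∃ a b : ℕ,
      max 1 (max ((normAbs F (p 0 + δ₁ * p 1) : ℝ≥0) : ℝ) ((normAbs F (δ₁ * p 2 - 2⁻¹ * (p 0 + δ₁ * p 1) * (p 0 - δ₁ * p 1)) : ℝ≥0) : ℝ)) = (residueFieldCard F : ℝ) ^ a ∧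
      max 1 (max ((normAbs F (-(p 0 - δ₁ * p 1)) : ℝ≥0) : ℝ)
          ((normAbs F (δ₁ * p 2 - 2⁻¹ * (p 0 + δ₁ * p 1) * (p 0 - δ₁ * p 1) - (p 0 + δ₁ * p 1) * (-(p 0 - δ₁ * p 1))) : ℝ≥0) : ℝ)) = (residueFieldCard F : ℝ) ^ b ∧
      ω p = ((χ₁ π : ℂˣ) : ℂ) ^ a * ((χ₂ π : ℂˣ) : ℂ) ^ b := by
  intro p
  obtain ⟨a, hA, hca⟩ := shell_of_unramified_weight _ (fun p => le_max_left _ _) χ₁ hχ₁ π hπ α₁ hα₁ c₁ hc₁1 hc₁A p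
  obtain ⟨b, hB, hcb⟩ := shell_of_unramified_weight _ (fun p => le_max_left _ _) χ₂ hχ₂ π hπ α₂ hα₂ c₂ hc₂1 hc₂B p
  exact ⟨a, b, hA, hB, by rw [hω p, hca, hcb]⟩

end Split

end Summit.HodgeConjecture.HodgeConjecture.Cruxes.H413.K2E1ChiLocalWeightShellU3

end
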